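import Summits.NavierStokesRegularity.NavierStokesRegularity.Theorems.TaoForcedUniqueness.Negative.CountableJunkForce
import Literature.Analysis.FluidPDE.ForcedSerrinMasudaUniqueness

/-!
# K54 kernel: weak–strong uniqueness FAILS in the typed force class — `¬ sohr2001_serrinMasuda_uniqueness_forced(_memLp)`

Cell `ns-blowup`, seat `ns-blowup-refuter4` (g0), KILLSHEET §XXV row K54 (pre-announced STATUS l.1933 as a
DISSENT on KJ-1's "no `¬` exists"). LABEL: refuter kernel certificate; NEGATIVE lemma (Negative lane,
`--supports` the route item `TaoForcedUniqueness` of `route-NavierStokesRegularity-PalasekTowerBreakdown`)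
refuting, in the kernel, BOTH Literature named facts
`Literature.Analysis.FluidPDE.sohr2001_serrinMasuda_uniqueness_forced_memLp` and its unguarded twin
`Literature.Analysis.FluidPDE.sohr2001_serrinMasuda_uniqueness_forced` (file
`Literature/Analysis/FluidPDE/ForcedSerrinMasudaUniqueness.lean`). WHAT THIS IS NOT: not Navier–Stokes
evidence (no blow-up, no regularity, nothing about the summit); not a refutation of a Theses decl; not a
claim against the PRINTED theorem (Sohr 2001, Ch. V Thm. 1.5.1), which is about Bochner forces and is
untouched — the refutation lives entirely in the typing surplus `MemLqLp 1 2 f` ⊋ `L¹(0,T; L²_σ)` exhibited by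
KJ-1 (`MemLqLpNonBochnerForce.lean`): CLASS **misstated** (missing side condition), REPAIR = add the joint
measurability hypothesis `AEStronglyMeasurable (uncurry f) ((volume.restrict (Ioo 0 T)).prod volume)`
(the shape of `LerayHopfTimeSliceForced`); the witness below is not jointly measurable, so it misses the
repaired statement.

## The mathematics (countable-direction junk force)

KJ-1's single switched direction `𝟙_M(t) g(x)` does not break uniqueness: the weak formulation then only
sees test fields `ψ ⊥ g`, a class still rich enough to pin the flow down. K54 uses COUNTABLY MANY
directions. Fix the smooth, divergence-free, non-compactly-supported profile
`U(x) = (1+|x|²)⁻² (-x₁, x₀, 0) ∈ H¹ ∩ L^p(ℝ³)` (§4) and a countable family `(g_a)_{a ≥ 1}` in the unit ball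
of `L²(ℝ³)³`, each `g_a ⊥ U`, which is TOTAL on `C_c(ℝ³)³`: a continuous compactly supported `φ` with
`∫⟪g_a, φ⟫ = 0` for all `a` vanishes (§5: `g_a` = normalised `ρ e_j - c U`, `ρ` running over bumps at
rational centres and radii; orthogonality to all of them forces `φ = αU`, and `U` is not compactly
supported). Let `ℓ : ℝ → ℕ` label a countable partition of the time axis into Halmos-saturated pieces
(tree `SaturatedPartition`: every measurable subset of `{ℓ ≠ a}` is null, for every `a`), `g_0 := 0`, and
```
  f(t, x) := U(x) + g_{ℓ(t)}(x),        u_ε(t, x) := ε t U(x).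
```
* `‖f(t)‖₂ ≤ ‖U‖₂ + 1` for all `t`, so `MemLqLp q 2 f S` for EVERY `q` and every `S` of finite measure
  (§6) — the typed hypothesis `∀ T' < T, MemLqLp 1 2 f (Ioo 0 T')` holds.
* **`u_ε` is a weak solution with force `f` and datum `0`** (§7). For a space–time test field `ψ` the
  weak-form time integrand splits as `H(t) + P(ℓ(t), t)` with `H` and every `P(a,·) = ∫⟪g_a, ψ(t)⟫`
  measurable. If the integrand is a.e.-strongly measurable on `(0,T)`, the labelling lemma (tree
  `ae_eq_of_aestronglyMeasurable_label`) gives `P(a,t) = P(ℓ(t),t) = P(0,t) = 0` for a.e. `t` and all `a`,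
  so by totality `ψ(t) = 0` for a.e. `t ∈ (0,T)`, hence (openness) for all `t ∈ (0,T)`, and the integrand
  vanishes identically; if it is not, its Bochner integral is `0` by Mathlib's convention
  (`integral_non_aestronglyMeasurable`). Either way the weak identity holds — for EVERY `ε`.
* **Energy** (§6, §8): the junk directions do no work on `u_ε` (`g_a ⊥ U`), so
  `∫⟪f(τ), u_ε(τ)⟫ = ετ‖U‖²`, and Leray's inequalities from `0` and from every `s` hold as soon as
  `ε (‖U‖² + 2νT ∫|∇U|²) ≤ ‖U‖²`; `u_ε ∈ L^∞L² ∩ L²Ḣ¹`, weakly and strongly continuous at `0`, and in every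
  Serrin class `L^s(0,T'; L^q)`, `2 ≤ q < ∞` (§6).
* Hence for `ν = T = 1`, `ε₁ = ‖U‖²/(‖U‖² + 2∫|∇U|²)`, `ε₂ = ε₁/2`, the fields `u_{ε₁} ≠ u_{ε₂}` are two
  Leray–Hopf solutions with the same `ν, f, u₀ = 0 ∈ L²`, the second in the Serrin class `L⁵L⁵`
  (`3/5 + 2/5 = 1`), contradicting the conclusion `w(t) = u(t)` a.e. at `t = 1/2` (§9).

Main results (namespace `Summit.NavierStokesRegularity.ForcedUniquenessCountableJunk`):
* `swirl_isDivFree`, `memLp_swirl`, `lintegral_frob_fderiv_swirl_lt_top`, `exists_swirl_ne_zero_not_mem` —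
  the profile;
* `eq_zero_of_forall_integral_inner_junk` — totality of the junk family modulo `U`;
* `isWeakNSSolutionOn_flow`, `isLerayHopfOn_flow`, `memLqLp_force`, `memLqLp_flow`;
* `not_sohr2001_serrinMasuda_uniqueness_forced_memLp`, `not_sohr2001_serrinMasuda_uniqueness_forced`.

Everything is PROVED (no `sorry`, no new named facts, standard axioms); the `def`s are explicit data
(profile, bumps, force, flows), not hypotheses. Consequence for the cell (planner RULING STATUS l.1928
already retired the Sohr twins from every glue path): any theorem taking either Sohr fact as a hypothesis
is vacuous; the forced weak–strong uniqueness slot needs the Bochner-typed statement (lean g3's F3 /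
`LerayHopfTimeSliceForced` shape).

References: H. Sohr, *The Navier–Stokes Equations. An Elementary Functional Analytic Approach*,
Birkhäuser 2001, Ch. V Thm. 1.5.1 (Serrin, Masuda) [cite: Sohr2001, Ch. V Thm. 1.5.1]; P. R. Halmos,
*Measure Theory* (1950), §16 Thm. E [cite: Halmos1950, §16 Theorem E]; J. Serrin, The initial value
problem for the Navier–Stokes equations (1963), §3 (the classes `L^{s}L^{q}`) [cite: Serrin1963, §3].
-/

noncomputable section

namespace Summit.NavierStokesRegularity.ForcedUniquenessCountableJunk

open MeasureTheory Set Filter Topology Function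
open scoped ENNReal NNReal RealInnerProductSpace Laplacian
open Literature.Analysis.FluidPDE

/-! ## §8 `u_ε` is a Leray–Hopf solution for small `ε` -/

/-- **`u_ε` is a Leray–Hopf weak solution** on `[0,T)` with force `f`, datum `0`, viscosity `ν ≥ 0`,
whenever `0 < ε` and `ε (‖U‖² + 2 ν T D_U) ≤ ‖U‖²`. [folklore] -/
theorem isLerayHopfOn_flow {ν T ε : ℝ} (hν : 0 ≤ ν) (hε : 0 < ε)
    (hεA : ε * (normSqU + 2 * ν * T * DU.toReal) ≤ normSqU) :
    IsLerayHopfOn T ν force (0 : EuclideanSpace ℝ (Fin 3) → EuclideanSpace ℝ (Fin 3)) (flow ε) where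
  weak := isWeakNSSolutionOn_flow T ν ε
  energy_bound := by
    have hS : eLpNorm swirl 2 volume ≠ ∞ := (memLp_swirl (p := 2) le_rfl (by simp)).eLpNorm_ne_top
    have hB : (ENNReal.ofReal (|ε| * |T|) * eLpNorm swirl 2 volume) ^ 2 ≠ ∞ :=
      ENNReal.pow_ne_top (ENNReal.mul_ne_top ENNReal.ofReal_ne_top hS)
    refine ⟨((ENNReal.ofReal (|ε| * |T|) * eLpNorm swirl 2 volume) ^ 2).toNNReal,
      (ae_restrict_iff' measurableSet_Ioo).2 (Eventually.of_forall fun t ht => ?_)⟩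
    rw [eEnergy_eq_eLpNorm_sq, eLpNorm_flow, ENNReal.coe_toNNReal hB]
    refine ENNReal.pow_le_pow_left (mul_le_mul' ?_ le_rfl)
    rw [Real.enorm_eq_ofReal_abs, abs_mul, abs_of_pos ht.1]
    exact ENNReal.ofReal_le_ofReal
      (mul_le_mul_of_nonneg_left (ht.2.le.trans (le_abs_self T)) (abs_nonneg ε))
  memLp := fun t _ => memLp_flow le_rfl (by simp) ε t
  weakGrad_energy := by
    refine ⟨fun t x => fderiv ℝ (flow ε t) x, Eventually.of_forall fun t =>
      hasWeakGradient_fderiv_of_contDiff (contDiff_flow ε t), ?_, fun t ht => ?_,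
      (ae_restrict_iff' measurableSet_Ioo).2 (Eventually.of_forall fun s hs t ht => ?_)⟩
    · -- `∇u_ε ∈ L²(0,T; L²)`
      simp_rw [lintegral_frob_flow]
      calc ∫⁻ t in Ioo 0 T, ENNReal.ofReal ((ε * t) ^ 2) * DU
          ≤ ∫⁻ _t in Ioo 0 T, ENNReal.ofReal ((ε * T) ^ 2) * DU := by
            refine setLIntegral_mono measurable_const fun t ht =>
              mul_le_mul' (ENNReal.ofReal_le_ofReal ?_) le_rfl
            rw [mul_pow, mul_pow]
            exact mul_le_mul_of_nonneg_left (pow_le_pow_left₀ ht.1.le ht.2.le 2) (sq_nonneg ε)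
        _ < ∞ := by
            rw [setLIntegral_const, Real.volume_Ioo]
            exact ENNReal.mul_lt_top (ENNReal.mul_lt_top ENNReal.ofReal_lt_top DU_lt_top)
              ENNReal.ofReal_lt_top
    · -- energy inequality from `0`
      have h := energy_ineq_flow hν hε hεA le_rfl ht.1 ht.2
      have h0 : VectorCalculus.kineticEnergy (flow ε 0) = 0 := by rw [kineticEnergy_flow]; simp
      have h0' : VectorCalculus.kineticEnergy (0 : EuclideanSpace ℝ (Fin 3) → EuclideanSpace ℝ (Fin 3)) = 0 := by
        simp [VectorCalculus.kineticEnergy]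
      rw [h0] at h
      rw [h0']
      exact h
    · -- energy inequality from a.e. `s`
      exact energy_ineq_flow hν hε hεA hs.1.le ht.1 ht.2
  weak_continuous := by
    intro w hw
    have hU := memLp_swirl (p := 2) le_rfl (by simp)
    have h : (fun t => ∫ x, ⟪flow ε t x, w x⟫) = fun t => ε * t * ∫ x, ⟪swirl x, w x⟫ := by
      funext t
      simp only [flow, real_inner_smul_left, integral_const_mul]
    rw [h]
    have hc : Continuous fun t : ℝ => ε * t * ∫ x, ⟪swirl x, w x⟫ :=
      (continuous_const.mul continuous_id).mul continuous_const
    refine ⟨hc.continuousOn, ?_⟩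
    have h0 : ∫ x, ⟪(0 : EuclideanSpace ℝ (Fin 3) → EuclideanSpace ℝ (Fin 3)) x, w x⟫ =
        ε * 0 * ∫ x, ⟪swirl x, w x⟫ := by simp
    rw [h0]
    exact tendsto_nhdsWithin_of_tendsto_nhds (hc.tendsto 0)
  strong_initial := by
    have hS : eLpNorm swirl 2 volume ≠ ∞ := (memLp_swirl (p := 2) le_rfl (by simp)).eLpNorm_ne_top
    simp_rw [sub_zero, eLpNorm_flow]
    rw [show (0 : ℝ≥0∞) = ‖ε * (0 : ℝ)‖ₑ * eLpNorm swirl 2 volume by simp]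
    refine ENNReal.Tendsto.mul_const (tendsto_nhdsWithin_of_tendsto_nhds ?_) (Or.inr hS)
    exact (continuous_enorm.comp (continuous_const.mul continuous_id)).tendsto 0

/-! ## §9 The refutation -/

/-- The Serrin pair `(s, q) = (5, 5)`: `3/5 + 2/5 = 1`. [folklore] -/
theorem three_div_five_add_two_div_five : (3 : ℝ≥0∞) / 5 + 2 / 5 ≤ 1 := by
  rw [ENNReal.div_add_div_same, show (3 : ℝ≥0∞) + 2 = 5 by norm_num,
    ENNReal.div_self (by norm_num) (by simp)]

/-- **Refutation of `sohr2001_serrinMasuda_uniqueness_forced_memLp` [refuted-misstated].**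
With the force `f = U + g_{ℓ(t)}` (`f ∈ L¹(0,T';L²)` for all `T'`, indeed `‖f(t)‖₂ ≤ ‖U‖₂ + 1`),
datum `u₀ = 0 ∈ L²`, `ν = T = 1`, the two flows `u_{ε₁}`, `u_{ε₂}` (`ε₂ = ε₁/2`,
`ε₁ = ‖U‖²/(‖U‖² + 2D_U)`) are Leray–Hopf solutions with the same data, both in every Serrin class
`L^s(0,T'; L^q)`, and they differ at `t = 1/2`. The printed theorem (Sohr 2001, Ch. V Thm. 1.5.1) is
about Bochner forces `f ∈ L¹(0,T; L²(ℝ³)³)`; the Lean class `MemLqLp 1 2` only sees slice norms, and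
the witness exploits a force that is not strongly measurable as an `L²`-valued map (its junk part
`g_{ℓ(t)}` ranges over a countable total family along a saturated non-measurable labelling). Minimal
repair `C′`: add `AEStronglyMeasurable (uncurry f) ((volume.restrict (Ioo 0 T)).prod volume)` (joint
measurability of the force) to the hypotheses — the witness then fails (its `f` is not jointly
measurable), and `C′` is the printed theorem. [cite: Sohr2001, Ch. V Thm. 1.5.1 (Serrin, Masuda); Halmos1950, §16 Thm. E] -/
theorem not_sohr2001_serrinMasuda_uniqueness_forced_memLp :
    ¬ sohr2001_serrinMasuda_uniqueness_forced_memLp := by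
  intro H
  set A := normSqU with hA
  set D := DU.toReal with hD
  have hApos : 0 < A := integral_inner_swirl_swirl_pos
  have hD0 : 0 ≤ D := ENNReal.toReal_nonneg
  set ε₁ : ℝ := A / (A + 2 * D) with hε₁
  set ε₂ : ℝ := ε₁ / 2 with hε₂
  have hden : 0 < A + 2 * D := by positivity
  have hε₁pos : 0 < ε₁ := div_pos hApos hden
  have hε₂pos : 0 < ε₂ := half_pos hε₁pos
  have hε₁A : ε₁ * (normSqU + 2 * 1 * 1 * DU.toReal) ≤ normSqU := by
    rw [← hA, ← hD, hε₁, show 2 * 1 * 1 * D = 2 * D by ring, div_mul_cancel₀ _ hden.ne']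
  have hε₂A : ε₂ * (normSqU + 2 * 1 * 1 * DU.toReal) ≤ normSqU := by
    have : ε₂ * (normSqU + 2 * 1 * 1 * DU.toReal) ≤ ε₁ * (normSqU + 2 * 1 * 1 * DU.toReal) := by
      rw [← hA, ← hD]
      exact mul_le_mul_of_nonneg_right (by linarith) (by positivity)
    exact this.trans hε₁A
  have h1 := isLerayHopfOn_flow (T := 1) zero_le_one hε₁pos hε₁A
  have h2 := isLerayHopfOn_flow (T := 1) zero_le_one hε₂pos hε₂A
  have hae := H one_pos one_pos (MemLp.zero : MemLp (0 : EuclideanSpace ℝ (Fin 3) → EuclideanSpace ℝ (Fin 3)) 2 volume) (fun T' hT' _ => memLqLp_force 1 (by simp [Real.volume_Ioo]))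
    h1 h2 (s := 5) (q := 5) (by norm_num) ENNReal.ofNat_lt_top (by norm_num) ENNReal.ofNat_lt_top
    three_div_five_add_two_div_five (fun T' _ _ => memLqLp_flow 5 (by norm_num) (by simp) ε₂ 0 T')
    (1 / 2) ⟨by norm_num, by norm_num⟩
  have heq : flow ε₂ (1 / 2) = flow ε₁ (1 / 2) :=
    (Continuous.ae_eq_iff_eq volume ((continuous_flow ε₂).comp (continuous_const.prodMk continuous_id))
      ((continuous_flow ε₁).comp (continuous_const.prodMk continuous_id))).1 hae
  have hpt := congr_fun heq (e 0)
  simp only [flow] at hpt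
  have hinj := smul_left_injective ℝ swirl_e0_ne_zero hpt
  have : ε₂ = ε₁ := by
    have h' : ε₂ * (1 / 2) = ε₁ * (1 / 2) := hinj
    linarith
  linarith

/-- **Refutation of the unguarded twin `sohr2001_serrinMasuda_uniqueness_forced`** (same class
[refuted-misstated], same repair): it implies the explicit-datum form
(`sohr2001_serrinMasuda_uniqueness_forced_memLp.of_unguarded`). [cite: Sohr2001, Ch. V Thm. 1.5.1 (Serrin, Masuda)] -/
theorem not_sohr2001_serrinMasuda_uniqueness_forced : ¬ sohr2001_serrinMasuda_uniqueness_forced :=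
  fun h => not_sohr2001_serrinMasuda_uniqueness_forced_memLp
    (sohr2001_serrinMasuda_uniqueness_forced_memLp.of_unguarded h)

end Summit.NavierStokesRegularity.ForcedUniquenessCountableJunk

end
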